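import Mathlib
import Literature.Computability.MetaComplexity.ScopeExpansion

/-!
# A Moore-type bound for `(r, 6)`-boundary expanders with `8`-point scopes, I: configurations
(route ExpanderLinearGenerators, item stmt-PneNP-11442, helper file)

This is the first of the files proving that in an `8`-sparse `(r, 3/4 · 8)`-boundary expander every
nonempty BOUNDARYLESS family of scopes (`∂F = ∅`, as the support of an `𝔽₂`-dependency of an
unsolvable system is) has at least `2^(⌊r⌋/8 - 1)` members — the locality `ℓ = 8` slice of the
expansion-scale law `ExpansionForcesDepthFregeSize`, where the law holds because the formula itself
is exponentially large in `r`.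

Here: the INCIDENCE GRAPH of a family of scopes (rows `Sum.inl a`, `a ∈ F`, points `Sum.inr v`,
`v ∈ S a`), given abstractly by its adjacency (`hG`), and the **configuration lemma**
`config_contra`: a subgraph `C` of the incidence graph in which every vertex has at least two
`C`-neighbours and some row has at least three, and which meets at most `r` rows, contradicts
`(r, 6)`-boundary expansion when scopes have `≤ 8` points. (Count incidences: the rows `I` of `C`
have `Σ |S a| ≤ 8|I|` incidences, at least `2|I| + 1` of them into points of `C`, none of which is
a boundary point of `I` since it lies in two rows of `I`; so `|∂I| ≤ 6|I| - 1`.)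

References: the Moore bound (girth versus minimum degree) is classical — N. Biggs, *Algebraic
Graph Theory* (CUP 1974), Ch. 23; its use here is this file's.
-/

namespace Summit.PneNP.PneNP.Theorems

set_option linter.dupNamespace false -- `Summit.PneNP.PneNP.…`: summit = sub-problem (D-0017)

namespace MooreBound

open Finset Literature.Computability.MetaComplexity

variable {ι : Type*} {S : ι → Finset ℕ} {F : Finset ι} {G : SimpleGraph (ι ⊕ ℕ)}

/-! ### The incidence graph, given by its adjacency relation -/

section Adjacency

variable (hG : ∀ x y, G.Adj x y ↔ ∃ a v, a ∈ F ∧ v ∈ S a ∧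
  ((x = Sum.inl a ∧ y = Sum.inr v) ∨ (x = Sum.inr v ∧ y = Sum.inl a)))
include hG

/-- A row–point pair is adjacent iff the row is in the family and the point in its scope.
[folklore] -/
theorem adj_inl_inr {a : ι} {v : ℕ} : G.Adj (Sum.inl a) (Sum.inr v) ↔ a ∈ F ∧ v ∈ S a := by
  rw [hG]
  constructor
  · rintro ⟨a', v', ha', hv', h | h⟩
    · obtain ⟨h1, h2⟩ := h
      cases h1; cases h2
      exact ⟨ha', hv'⟩
    · exact absurd h.1 (by simp)
  · rintro ⟨ha, hv⟩
    exact ⟨a, v, ha, hv, Or.inl ⟨rfl, rfl⟩⟩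

/-- Symmetric form of `adj_inl_inr`. [folklore] -/
theorem adj_inr_inl {a : ι} {v : ℕ} : G.Adj (Sum.inr v) (Sum.inl a) ↔ a ∈ F ∧ v ∈ S a := by
  rw [G.adj_comm]
  exact adj_inl_inr hG

/-- Rows are not adjacent to rows. [folklore] -/
theorem not_adj_inl_inl {a a' : ι} : ¬ G.Adj (Sum.inl a) (Sum.inl a') := by
  rw [hG]
  rintro ⟨a'', v, -, -, h | h⟩
  · exact absurd h.2 (by simp)
  · exact absurd h.1 (by simp)

/-- Points are not adjacent to points. [folklore] -/
theorem not_adj_inr_inr {v v' : ℕ} : ¬ G.Adj (Sum.inr v) (Sum.inr v') := by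
  rw [hG]
  rintro ⟨a, v'', -, -, h | h⟩
  · exact absurd h.1 (by simp)
  · exact absurd h.2 (by simp)

/-- A neighbour of a row is a point of its scope (and the row is in the family). [folklore] -/
theorem adj_inl_iff {a : ι} {y : ι ⊕ ℕ} :
    G.Adj (Sum.inl a) y ↔ ∃ v, y = Sum.inr v ∧ a ∈ F ∧ v ∈ S a := by
  cases y with
  | inl a' => simpa using not_adj_inl_inl hG
  | inr v => simp [adj_inl_inr hG]

/-- A neighbour of a point is a row of the family whose scope contains it. [folklore] -/
theorem adj_inr_iff {v : ℕ} {y : ι ⊕ ℕ} :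
    G.Adj (Sum.inr v) y ↔ ∃ a, y = Sum.inl a ∧ a ∈ F ∧ v ∈ S a := by
  cases y with
  | inl a => simp [adj_inr_inl hG]
  | inr v' => simpa using not_adj_inr_inr hG

/-- Every vertex of the incidence graph has finitely many neighbours. [folklore] -/
theorem finite_neighborSet (x : ι ⊕ ℕ) : (G.neighborSet x).Finite := by
  cases x with
  | inl a =>
    refine (Set.finite_range (fun v : S a => (Sum.inr (v : ℕ) : ι ⊕ ℕ))).subset ?_
    intro y hy
    obtain ⟨v, rfl, -, hv⟩ := (adj_inl_iff hG).1 hy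
    exact ⟨⟨v, hv⟩, rfl⟩
  | inr v =>
    refine (Set.finite_range (fun a : F => (Sum.inl (a : ι) : ι ⊕ ℕ))).subset ?_
    intro y hy
    obtain ⟨a, rfl, ha, -⟩ := (adj_inr_iff hG).1 hy
    exact ⟨⟨a, ha⟩, rfl⟩

/-- Neighbour sets in subgraphs of the incidence graph are finite. [folklore] -/
theorem finite_neighborSet_subgraph (C : G.Subgraph) (x : ι ⊕ ℕ) : (C.neighborSet x).Finite :=
  (finite_neighborSet hG x).subset (C.neighborSet_subset x)

/-- Two distinct neighbours give `ncard ≥ 2`. [folklore] -/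
theorem two_le_ncard_neighborSet {C : G.Subgraph} {x y₁ y₂ : ι ⊕ ℕ} (h₁ : C.Adj x y₁)
    (h₂ : C.Adj x y₂) (hne : y₁ ≠ y₂) : 2 ≤ (C.neighborSet x).ncard :=
  (Set.one_lt_ncard_iff (finite_neighborSet_subgraph hG C x)).2 ⟨y₁, y₂, h₁, h₂, hne⟩

/-- Three pairwise distinct neighbours give `ncard ≥ 3`. [folklore] -/
theorem three_le_ncard_neighborSet {C : G.Subgraph} {x y₁ y₂ y₃ : ι ⊕ ℕ} (h₁ : C.Adj x y₁)
    (h₂ : C.Adj x y₂) (h₃ : C.Adj x y₃) (h₁₂ : y₁ ≠ y₂) (h₁₃ : y₁ ≠ y₃) (h₂₃ : y₂ ≠ y₃) :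
    3 ≤ (C.neighborSet x).ncard :=
  (Set.two_lt_ncard_iff (finite_neighborSet_subgraph hG C x)).2
    ⟨y₁, y₂, y₃, h₁, h₂, h₃, h₁₂, h₁₃, h₂₃⟩

/-! ### The configuration lemma -/

variable [DecidableEq ι]

/-- **Configuration lemma.** In the incidence graph of scopes with `≤ 8` points forming an
`(r, 6)`-boundary expander there is no subgraph `C` meeting at most `r` rows in which every vertex
has at least two `C`-neighbours and some row has at least three. (The rows `I` of `C` carry
`≤ 8|I|` incidences, `≥ 2|I| + 1` of them into `C`-neighbours, and a `C`-neighbour of a row of `I`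
lies in two rows of `I`, hence outside `∂I`: `|∂I| ≤ 6|I| - 1`.) The size hypothesis is given by a
list `L` through which all vertices of `C` pass (in applications: the supports of the walks `C` is
built from). [folklore] -/
theorem config_contra (hS8 : ∀ a ∈ F, (S a).card ≤ 8) {r : ℝ} (hexp : IsBoundaryExpander S r 6)
    (C : G.Subgraph) (h2 : ∀ x ∈ C.verts, 2 ≤ (C.neighborSet x).ncard) {b : ι}
    (h3 : 3 ≤ (C.neighborSet (Sum.inl b)).ncard)
    {L : List (ι ⊕ ℕ)} (hL : ∀ x ∈ C.verts, x ∈ L) (hr : (L.length : ℝ) ≤ r) : False := by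
  classical
  set I : Finset ι := F.filter fun a => Sum.inl a ∈ C.verts with hI
  -- `|I| ≤ |L| ≤ r`
  have hIr : (I.card : ℝ) ≤ r := by
    have h1 : I.card ≤ L.length := by
      calc I.card = (I.image fun a => (Sum.inl a : ι ⊕ ℕ)).card :=
            (Finset.card_image_of_injective _ Sum.inl_injective).symm
        _ ≤ L.toFinset.card := Finset.card_le_card fun x hx => by
            obtain ⟨a, ha, rfl⟩ := Finset.mem_image.1 hx
            exact List.mem_toFinset.2 (hL _ (Finset.mem_filter.1 ha).2)
        _ ≤ L.length := List.toFinset_card_le L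
    exact le_trans (by exact_mod_cast h1) hr
  -- the `C`-neighbours of a row, as points of its scope
  set T : ι → Finset ℕ := fun a => (S a).filter fun v => C.Adj (Sum.inl a) (Sum.inr v) with hT
  have hTsub : ∀ a, T a ⊆ S a := fun a => Finset.filter_subset _ _
  -- rows of `C` adjacent to something are rows of `I`
  have hmemI : ∀ {a : ι} {y : ι ⊕ ℕ}, C.Adj (Sum.inl a) y → a ∈ I := by
    intro a y h
    obtain ⟨v, rfl, ha, -⟩ := (adj_inl_iff hG).1 h.adj_sub
    exact Finset.mem_filter.2 ⟨ha, h.fst_mem⟩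
  -- (1) `b ∈ I`
  have hbI : b ∈ I := by
    have hpos : 0 < (C.neighborSet (Sum.inl b)).ncard := by omega
    obtain ⟨y, hy⟩ := Set.nonempty_of_ncard_ne_zero hpos.ne'
    exact hmemI hy
  -- (2) the `C`-degree of a row is at most `|T a|`
  have hdegT : ∀ a, (C.neighborSet (Sum.inl a)).ncard ≤ (T a).card := by
    intro a
    have hsub : C.neighborSet (Sum.inl a) ⊆ (fun v : ℕ => (Sum.inr v : ι ⊕ ℕ)) '' (T a : Set ℕ) := by
      intro y hy
      have hy' : C.Adj (Sum.inl a) y := hy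
      obtain ⟨v, rfl, -, hv⟩ := (adj_inl_iff hG).1 hy'.adj_sub
      exact ⟨v, by simp [hT, hv, hy'], rfl⟩
    calc (C.neighborSet (Sum.inl a)).ncard
        ≤ ((fun v : ℕ => (Sum.inr v : ι ⊕ ℕ)) '' (T a : Set ℕ)).ncard :=
          Set.ncard_le_ncard hsub ((Finset.finite_toSet _).image _)
      _ = (T a).card := by
          rw [Set.ncard_image_of_injective _ Sum.inr_injective, Set.ncard_coe_finset]
  -- (3) `Σ_{a ∈ I} |T a| ≥ 2|I| + 1`
  have hsumT : 2 * I.card + 1 ≤ ∑ a ∈ I, (T a).card := by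
    have h1 : ∀ a ∈ I.erase b, 2 ≤ (T a).card := fun a ha => by
      have haI := Finset.mem_of_mem_erase ha
      exact (h2 _ (Finset.mem_filter.1 haI).2).trans (hdegT a)
    have h2' : 2 * (I.erase b).card ≤ ∑ a ∈ I.erase b, (T a).card := by
      calc 2 * (I.erase b).card = ∑ _a ∈ I.erase b, 2 := by
            rw [Finset.sum_const, smul_eq_mul, mul_comm]
        _ ≤ ∑ a ∈ I.erase b, (T a).card := Finset.sum_le_sum h1
    have h3' : 3 ≤ (T b).card := h3.trans (hdegT b)
    rw [← Finset.sum_erase_add _ _ hbI]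
    have := Finset.card_erase_add_one hbI
    omega
  -- (4) no `C`-neighbour of a row of `I` is a boundary point of `I`
  have hbd : boundary S I ⊆ I.biUnion fun a => S a \ T a := by
    intro v hv
    obtain ⟨a, ⟨haI, hva⟩, huniq⟩ := existsUnique_of_mem_boundary hv
    refine Finset.mem_biUnion.2 ⟨a, haI, Finset.mem_sdiff.2 ⟨hva, fun hvT => ?_⟩⟩
    have hadj : C.Adj (Sum.inl a) (Sum.inr v) := (Finset.mem_filter.1 hvT).2
    have hv2 := h2 _ hadj.snd_mem
    obtain ⟨x₁, x₂, hx₁, hx₂, hne⟩ :=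
      (Set.one_lt_ncard_iff (finite_neighborSet_subgraph hG C (Sum.inr v))).1 (by omega)
    have key : ∀ x ∈ C.neighborSet (Sum.inr v), x = Sum.inl a := by
      intro x hx
      have hx' : C.Adj (Sum.inr v) x := hx
      obtain ⟨a', rfl, -, hva'⟩ := (adj_inr_iff hG).1 hx'.adj_sub
      rw [huniq a' ⟨hmemI hx'.symm, hva'⟩]
    exact hne ((key x₁ hx₁).trans (key x₂ hx₂).symm)
  -- (5) counting
  have hcount : (boundary S I).card + ∑ a ∈ I, (T a).card ≤ ∑ a ∈ I, (S a).card := by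
    have h1 : (boundary S I).card ≤ ∑ a ∈ I, (S a \ T a).card :=
      (Finset.card_le_card hbd).trans Finset.card_biUnion_le
    have h2 : ∑ a ∈ I, (S a \ T a).card + ∑ a ∈ I, (T a).card = ∑ a ∈ I, (S a).card := by
      rw [← Finset.sum_add_distrib]
      exact Finset.sum_congr rfl fun a _ => Finset.card_sdiff_add_card_eq_card (hTsub a)
    omega
  have hS8I : ∑ a ∈ I, (S a).card ≤ 8 * I.card := by
    calc ∑ a ∈ I, (S a).card ≤ ∑ _a ∈ I, 8 :=
          Finset.sum_le_sum fun a ha => hS8 a (Finset.mem_filter.1 ha).1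
      _ = 8 * I.card := by rw [Finset.sum_const, smul_eq_mul, mul_comm]
  have hexpI : (6 : ℝ) * I.card ≤ (boundary S I).card := hexp I hIr
  have hexpI' : 6 * I.card ≤ (boundary S I).card := by exact_mod_cast hexpI
  omega

end Adjacency

end MooreBound

end Summit.PneNP.PneNP.Theorems
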